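import Literature.Geometry.Lorentzian.KerrRedShiftCoercivity
import Literature.Geometry.Lorentzian.KerrLeafEnergyComparison
import HarnessLib

/-!
# The red-shift multiplier is future timelike on a collar of the Kerr horizon, uniformly
# transversal to the admissible leaves (Dafermos–Rodnianski–Shlapentokh-Rothman, Prop. 4.5.1:
# "a `φ_τ`-invariant timelike vector field `N`"), and the collar principle behind "by continuity"

(family `gr`; namespace `Literature.Geometry.Lorentzian.Kerr`; written from the proving seat of the
named fact
`Literature.Geometry.Lorentzian.DafermosRodnianskiShlapentokhRothman2016_energyBoundedness_horizonRegular`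
(`KerrHorizonRegularWaveBoundedness.lean`), continuing `KerrRedShiftCoercivity.lean` towards the
red-shift estimate Prop. 4.5.2 of DRSR arXiv:1402.7034, the near-horizon ingredient of its §13.2. No
named fact is introduced (D-0026); everything is proved.)

Dafermos–Rodnianski–Shlapentokh-Rothman (arXiv:1402.7034 = Ann. of Math. 183 (2016), Prop. 4.5.1,
from Dafermos–Rodnianski arXiv:0811.0354, §3.3.2 and Thm. 7.1) assert that the red-shift vector field
`N` is a *`φ_τ`-invariant timelike* vector field on `𝓡` ("normalised so that `N − K` is future
oriented"); in the energy identities of §2.3.2 this is what makes the boundary terms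
`∫_{Σ_τ} J^N_μ n^μ`, `∫_{𝓗⁺} J^N_μ n^μ` non-negative (dominant energy condition). For the explicit
transcription `N = (1 + h₁(r − r₊))K + (1 + f₁(r − r₊))k` of `KerrRedShiftBulk.lean`
(`Kerr.redShiftVector`) this file proves, on a two-sided collar `|r − r₊| ≤ η` of the horizon:

* `Kerr.exists_collar_of_pos_on_horizon` (**the collar principle**, the content of the printed
  "by continuity", made uniform by compactness and stationarity): a function `f(x, y)`, jointly
  continuous on `{r > 0} × T` for a compact parameter set `T`, invariant under `t*`-translations in
  `x` and positive at the points of `{r = r₁} × T`, is bounded below by a positive constant on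
  `{|r − r₁| ≤ η} × T` for some `η > 0` (`exists_collar_of_pos_on_horizon'`: no parameters);
* `Kerr.redShiftVec` — `N(x)` as a vector of `E4` (`redShiftVec_apply`: its components are
  `Kerr.redShiftVector`), `Kerr.bilin_redShiftVec` —
  `g(N, N) = (1 + h₁s)² g(K, K) − 2(1 + h₁s)(1 + f₁s) ℓ(K)`, `s = r − r₊` (`g(ℓ♯, ℓ♯) = 0`,
  `g(K, ℓ♯) = ℓ(K)`), and on the horizon `g(N, N) = −1/H < 0`
  (`bilin_redShiftVec_of_radius_eq_rPlus`, `bilin_redShiftVec_neg_of_radius_eq_rPlus`: `g(K, K) = 0`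
  by `Kerr.bilin_drsrVector_eq_zero`, `2H ℓ(K) = 1` by
  `Kerr.two_mul_scalarH_mul_hawkingComp_nullCovectorFun`);
* `Kerr.redShiftVec_apply_zero` — `N⁰ = 2 + (h₁ + f₁)(r − r₊)` (so `dt*(N) > 0` near `𝓗⁺`: `N` lies
  in the cone of the time orientation `V = −g♯dt*`, `g(N, V) = −N⁰`);
* `Kerr.admissibleConormals` — the compact set of covectors `n = (1, −q)`, `|q| ≤ 1` (the conormals
  `dt* − dF` of graphs with `‖∇F‖ ≤ 1`), and
  `Kerr.one_sub_le_sum_mul_redShiftVec_of_radius_eq_rPlus` — on the horizon, for every admissible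
  `n`, `n(N) = ∑_μ n_μ N^μ ≥ 1 − |a|/√(r₊² + a²) > 0`: `N` is uniformly transversal to every such
  graph (`N⁰ = 2`, `N⃗ = ω₊Φ⃗ − ℓ⃗`, `|ℓ⃗| = 1`, `ω₊|Φ⃗| ≤ |a|√(r₊² + a²)/(2Mr₊) = |a|/√(r₊² + a²)`,
  `spatialNorm_redShiftVec_le_of_radius_eq_rPlus`, `abs_div_sqrt_rPlus_sq_add_sq_lt_one`);
* `Kerr.exists_redShift_timelike_collar` (**Prop. 4.5.1, "timelike", near `𝓗⁺`, with uniform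
  constants**): for `|a| < M` and any `h₁, f₁` there are `η > 0` and `b > 0` such that at every `x`
  with `|r(x) − r₊| ≤ η`: `g(N, N) ≤ −b`, `N⁰ ≥ 1`, and `n(N) ≥ b` for every admissible conormal `n`
  (the collar principle applied to `−g(N, N)` and to `(x, n) ↦ n(N(x))`).

These are exactly the hypotheses under which the dominant energy condition
(`LorentzianMetric.stressEnergy_nonneg_of_isTimelike`, through the bridge
`Kerr.sum_multiplierCurrent_mul_eq_stressEnergy`) signs the `J^N`-fluxes through the admissible
leaves and through the receding inner hypersurfaces used in place of `𝓗⁺`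
(`KerrHorizonRegularWaveBoundednessProofs.lean`); the integrated estimate is left to the sequel.

## References

* M. Dafermos, I. Rodnianski, Y. Shlapentokh-Rothman, Ann. of Math. 183 (2016), arXiv:1402.7034:
  §4.5, Prop. 4.5.1; §2.3.2 (signs of boundary terms); §13.2
  (key `DafermosRodnianskiShlapentokhrothman2014`).
* M. Dafermos, I. Rodnianski, *Lectures on black holes and linear waves*, arXiv:0811.0354: §3.3.2
  ("`N` is timelike … by continuity"), Thm. 7.1, App. C–D (key `DafermosRodnianski2008`).
-/

noncomputable section

open Set Filter Metric
open scoped Topology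

namespace Literature.Geometry.Lorentzian

namespace Kerr

variable {M a : ℝ} {x : E4}

/-! ## Part 1. The collar principle -/

/-- **The collar principle** ("by continuity", uniformly: Dafermos–Rodnianski arXiv:0811.0354,
proof of Thm. 7.1). Let `T` be a compact set of parameters and `f : E4 → Y → ℝ` be jointly
continuous on `{r > 0} × T`, invariant under `t*`-translations in the point, and positive at every
point of `{r = r₁} × T` (`r₁ > 0`). Then there are `η > 0` and `b > 0` with `b ≤ f x y` whenever
`|r(x) − r₁| ≤ η` and `y ∈ T`. Proof: a positive minimum `m` on the compact
`{x⁰ = 0, r = r₁} × T`; the closed subset of the compact `{x⁰ = 0, |r − r₁| ≤ r₁/2} × T` where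
`f ≤ m/2` is compact and misses `{r = r₁}`, so `|r − r₁|` has a positive minimum on it; stationarity
removes `x⁰ = 0`. [cite: DafermosRodnianski2008, Thm. 7.1] -/
theorem exists_collar_of_pos_on_horizon {Y : Type*} [TopologicalSpace Y] [T2Space Y] (a : ℝ) {r₁ : ℝ}
    (hr₁ : 0 < r₁) {T : Set Y} (hT : IsCompact T) (f : E4 → Y → ℝ)
    (hcont : ContinuousOn (fun q : E4 × Y ↦ f q.1 q.2) ({x | 0 < radius a x} ×ˢ T))
    (hinv : ∀ (x : E4) (t : ℝ) (y : Y), f (x + t • E4.basisVector 0) y = f x y)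
    (hpos : ∀ x : E4, radius a x = r₁ → ∀ y ∈ T, 0 < f x y) :
    ∃ η : ℝ, 0 < η ∧ ∃ b : ℝ, 0 < b ∧ ∀ x : E4, |radius a x - r₁| ≤ η → ∀ y ∈ T, b ≤ f x y := by
  set Φ : E4 × Y → ℝ := fun q ↦ f q.1 q.2 with hΦ
  -- the compact sets
  set K₁ : Set E4 := {x | x 0 = 0 ∧ |radius a x - r₁| ≤ r₁ / 2} with hK₁
  set K₀ : Set E4 := {x | x 0 = 0 ∧ radius a x = r₁} with hK₀
  have hK₁c : IsCompact K₁ := isCompact_timeZero_radius_slab a (by linarith)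
  have hK₀₁ : K₀ ⊆ K₁ := fun x hx ↦ ⟨hx.1, by rw [hx.2, sub_self, abs_zero]; positivity⟩
  have hK₀c : IsCompact K₀ := by
    refine hK₁c.of_isClosed_subset ?_ hK₀₁
    rw [hK₀, Set.setOf_and]
    refine IsClosed.inter ?_ (isClosed_eq (continuous_radius a) continuous_const)
    have hc : Continuous fun x : E4 ↦ x 0 := (E4.dx 0).continuous
    exact isClosed_eq hc continuous_const
  have hpos₁ : ∀ x ∈ K₁, 0 < radius a x := fun x hx ↦ by
    have := (abs_le.mp hx.2).1
    linarith
  have hU₁ : K₁ ×ˢ T ⊆ {x : E4 | 0 < radius a x} ×ˢ T := Set.prod_mono (fun x hx ↦ hpos₁ x hx) subset_rfl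
  have hΦ₁ : ContinuousOn Φ (K₁ ×ˢ T) := hcont.mono hU₁
  -- the statement is vacuous if `T = ∅`; otherwise `K₀ × T ≠ ∅`
  rcases T.eq_empty_or_nonempty with hTe | ⟨y₀, hy₀⟩
  · exact ⟨1, one_pos, 1, one_pos, fun x _ y hy ↦ by simp [hTe] at hy⟩
  -- Step 1: a positive minimum on `K₀ × T`
  have hne₀ : (K₀ ×ˢ T).Nonempty := by
    refine ⟨(r₁ • E4.basisVector 3, y₀), ⟨?_, ?_⟩, hy₀⟩
    · simp [E4.basisVector]
    · exact radius_smul_basisVector_three a hr₁.le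
  obtain ⟨q₀, hq₀, hmin⟩ :=
    (hK₀c.prod hT).exists_isMinOn hne₀ (hΦ₁.mono (Set.prod_mono hK₀₁ subset_rfl))
  set m := Φ q₀ with hm_def
  have hm : 0 < m := hpos q₀.1 hq₀.1.2 q₀.2 hq₀.2
  have hmin' : ∀ q ∈ K₀ ×ˢ T, m ≤ Φ q := fun q hq ↦ (isMinOn_iff.mp hmin) q hq
  -- Step 2: the set where `f` is small stays away from `{r = r₁}`
  set b := m / 2 with hb_def
  have hb : 0 < b := by positivity
  set C : Set (E4 × Y) := (K₁ ×ˢ T) ∩ Φ ⁻¹' Iic b with hC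
  have hCclosed : IsClosed C :=
    hΦ₁.preimage_isClosed_of_isClosed (hK₁c.prod hT).isClosed isClosed_Iic
  have hCc : IsCompact C := (hK₁c.prod hT).of_isClosed_subset hCclosed inter_subset_left
  have hCr : ∀ q ∈ C, radius a q.1 ≠ r₁ := by
    intro q hq heq
    have h1 : m ≤ Φ q := hmin' q ⟨⟨hq.1.1.1, heq⟩, hq.1.2⟩
    have h2 : Φ q ≤ b := hq.2
    linarith
  have hη : ∃ η : ℝ, 0 < η ∧ η ≤ r₁ / 2 ∧ ∀ q ∈ C, η < |radius a q.1 - r₁| := by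
    rcases C.eq_empty_or_nonempty with hCe | hCne
    · exact ⟨r₁ / 2, by positivity, le_rfl, fun q hq ↦ by simp [hCe] at hq⟩
    · have hg : Continuous fun q : E4 × Y ↦ |radius a q.1 - r₁| :=
        (((continuous_radius a).comp continuous_fst).sub continuous_const).abs
      obtain ⟨q₁, hq₁, hmin₁⟩ := hCc.exists_isMinOn hCne hg.continuousOn
      have hδ₀ : 0 < |radius a q₁.1 - r₁| := abs_pos.mpr (sub_ne_zero.mpr (hCr q₁ hq₁))
      refine ⟨min (|radius a q₁.1 - r₁| / 2) (r₁ / 2), lt_min (by positivity) (by positivity),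
        min_le_right _ _, fun q hq ↦ ?_⟩
      have := (isMinOn_iff.mp hmin₁) q hq
      have h2 := min_le_left (|radius a q₁.1 - r₁| / 2) (r₁ / 2)
      linarith
  obtain ⟨η, hη0, hηle, hηC⟩ := hη
  -- Step 3: on the slab `x⁰ = 0`, `|r − r₁| ≤ η`, `f ≥ b`
  have hslab : ∀ x : E4, x 0 = 0 → |radius a x - r₁| ≤ η → ∀ y ∈ T, b ≤ Φ (x, y) := by
    intro x hx0 hxr y hyT
    by_contra hlt
    push Not at hlt
    have hq : (x, y) ∈ C := ⟨⟨⟨hx0, hxr.trans hηle⟩, hyT⟩, hlt.le⟩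
    have := hηC _ hq
    exact absurd hxr (not_le.mpr this)
  -- Step 4: remove `x⁰ = 0` by stationarity
  refine ⟨η, hη0, b, hb, fun x hxr y hy ↦ ?_⟩
  set x₀ : E4 := x + (-(x 0)) • E4.basisVector 0 with hx₀_def
  have hx₀0 : x₀ 0 = 0 := by simp [hx₀_def, E4.basisVector]
  have hx₀r : radius a x₀ = radius a x := radius_add_time_smul_basisVector a x _
  have hfx : f x y = f x₀ y := (hinv x (-(x 0)) y).symm
  rw [hfx]
  exact hslab x₀ hx₀0 (hx₀r ▸ hxr) y hy

/-- The parameter-free collar principle: a `t*`-invariant function continuous on `{r > 0}` and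
positive on `{r = r₁}` is `≥ b > 0` on a collar `|r − r₁| ≤ η`. [cite: DafermosRodnianski2008, Thm. 7.1] -/
theorem exists_collar_of_pos_on_horizon' (a : ℝ) {r₁ : ℝ} (hr₁ : 0 < r₁) (f : E4 → ℝ)
    (hcont : ContinuousOn f {x | 0 < radius a x})
    (hinv : ∀ (x : E4) (t : ℝ), f (x + t • E4.basisVector 0) = f x)
    (hpos : ∀ x : E4, radius a x = r₁ → 0 < f x) :
    ∃ η : ℝ, 0 < η ∧ ∃ b : ℝ, 0 < b ∧ ∀ x : E4, |radius a x - r₁| ≤ η → b ≤ f x := by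
  have h := exists_collar_of_pos_on_horizon (Y := Unit) a hr₁ (T := univ) isCompact_univ
    (fun x _ ↦ f x) ((hcont.comp continuousOn_fst fun q hq ↦ hq.1)) (fun x t _ ↦ hinv x t)
    (fun x hx _ _ ↦ hpos x hx)
  obtain ⟨η, hη, b, hb, h⟩ := h
  exact ⟨η, hη, b, hb, fun x hx ↦ h x hx () (mem_univ _)⟩

/-! ## Part 2. The red-shift multiplier as a vector; `g(N, N)` and `N⁰` -/

/-- **The red-shift multiplier `N(x)` as a vector of `E4`**:
`N = (1 + h₁(r − r₊)) K − (1 + f₁(r − r₊)) ℓ♯` (`k = −ℓ♯`); its components are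
`Kerr.redShiftVector` (`redShiftVec_apply`). [cite: DafermosRodnianskiShlapentokhrothman2014, Prop. 4.5.1] -/
def redShiftVec (M a h₁ f₁ : ℝ) (x : E4) : E4 :=
  (1 + h₁ * (radius a x - rPlus M a)) • hawkingVector M a x +
    (-(1 + f₁ * (radius a x - rPlus M a))) • nullVector a x

/-- The components of `redShiftVec` are `redShiftVector`. [folklore] -/
theorem redShiftVec_apply (M a h₁ f₁ : ℝ) (x : E4) (μ : Fin 4) :
    redShiftVec M a h₁ f₁ x μ = redShiftVector M a h₁ f₁ x μ := by
  simp only [redShiftVec, redShiftVector, PiLp.add_apply, PiLp.smul_apply, smul_eq_mul]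

/-- **`g(N, N) = (1 + h₁s)² g(K, K) − 2(1 + h₁s)(1 + f₁s) ℓ(K)`**, `s = r − r₊`, wherever `r > 0`:
expand bilinearly and use `g(ℓ♯, ℓ♯) = 0`, `g(K, ℓ♯) = g(ℓ♯, K) = ℓ(K)`. [folklore] -/
theorem bilin_redShiftVec (M a h₁ f₁ : ℝ) (hx : 0 < radius a x) :
    bilin M a x (redShiftVec M a h₁ f₁ x) (redShiftVec M a h₁ f₁ x) =
      (1 + h₁ * (radius a x - rPlus M a)) ^ 2 *
          bilin M a x (hawkingVector M a x) (hawkingVector M a x) -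
        2 * (1 + h₁ * (radius a x - rPlus M a)) * (1 + f₁ * (radius a x - rPlus M a)) *
          nullCovector a x (hawkingVector M a x) := by
  have h1 : bilin M a x (nullVector a x) (hawkingVector M a x) = nullCovector a x (hawkingVector M a x) :=
    bilin_nullVector_left M hx _
  have h2 : bilin M a x (hawkingVector M a x) (nullVector a x) = nullCovector a x (hawkingVector M a x) := by
    rw [bilin_symm]; exact h1
  have h3 := bilin_nullVector_nullVector M a hx
  simp only [redShiftVec, map_add, map_smul, add_apply, FunLike.coe_smul, Pi.smul_apply,
    smul_eq_mul, h1, h2, h3]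
  ring

/-- `ℓ(K) = ∑_μ K^μ ℓ_μ` (`= Kerr.hawkingComp M a x ℓ`). [folklore] -/
theorem nullCovector_hawkingVector (M a : ℝ) (x : E4) :
    nullCovector a x (hawkingVector M a x) = hawkingComp M a x (nullCovectorFun a x) := by
  rw [nullCovector, E4.covector_apply, hawkingComp]
  exact Finset.sum_congr rfl fun μ _ ↦ mul_comm _ _

/-- **On the horizon `g(N, N) = −1/H < 0`** (`|a| ≤ M`, `0 < M`, `r = r₊`): `g(K, K) = 0` there
(`Kerr.bilin_drsrVector_eq_zero`, `K` is the null generator) and `2H ℓ(K) = 1`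
(`Kerr.two_mul_scalarH_mul_hawkingComp_nullCovectorFun`), so `g(N, N) = −2ℓ(K) = −1/H`.
[cite: DafermosRodnianskiShlapentokhrothman2014, §2.2.2] -/
theorem bilin_redShiftVec_of_radius_eq_rPlus (h₁ f₁ : ℝ) (hMa : |a| ≤ M) (hM : 0 < M)
    (hr : radius a x = rPlus M a) :
    bilin M a x (redShiftVec M a h₁ f₁ x) (redShiftVec M a h₁ f₁ x) = -(scalarH M a x)⁻¹ := by
  have hx : 0 < radius a x := hr ▸ rPlus_pos hM a
  have hKK : bilin M a x (hawkingVector M a x) (hawkingVector M a x) = 0 := by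
    rw [← drsrVector_eq_hawkingVector_of_radius_eq hMa hM hr]
    exact bilin_drsrVector_eq_zero hMa hM hr
  have hℓ := two_mul_scalarH_mul_hawkingComp_nullCovectorFun hMa hM hr
  have hH : scalarH M a x ≠ 0 := by
    intro h0
    rw [h0, mul_zero, zero_mul] at hℓ
    exact zero_ne_one hℓ
  rw [bilin_redShiftVec M a h₁ f₁ hx, hKK, hr, sub_self, nullCovector_hawkingVector]
  field_simp
  linear_combination -hℓ

/-- **On the horizon `N` is timelike**: `g(N, N) < 0` at `r = r₊` (`|a| ≤ M`, `0 < M`).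
[cite: DafermosRodnianskiShlapentokhrothman2014, Prop. 4.5.1] -/
theorem bilin_redShiftVec_neg_of_radius_eq_rPlus (h₁ f₁ : ℝ) (hMa : |a| ≤ M) (hM : 0 < M)
    (hr : radius a x = rPlus M a) :
    bilin M a x (redShiftVec M a h₁ f₁ x) (redShiftVec M a h₁ f₁ x) < 0 := by
  have hx : 0 < radius a x := hr ▸ rPlus_pos hM a
  rw [bilin_redShiftVec_of_radius_eq_rPlus h₁ f₁ hMa hM hr, neg_lt_zero, inv_pos]
  exact scalarH_pos hM hx

/-- **`N⁰ = 2 + (h₁ + f₁)(r − r₊)`** (`K⁰ = 1`, `(ℓ♯)⁰ = −1`): in particular `dt*(N) > 0` near the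
horizon, i.e. `g(N, V) = −N⁰ < 0` for the time orientation `V = −g♯dt*`, so that `N` is future
directed. [cite: DafermosRodnianskiShlapentokhrothman2014, Prop. 4.5.1] -/
theorem redShiftVec_apply_zero (M a h₁ f₁ : ℝ) (x : E4) :
    redShiftVec M a h₁ f₁ x 0 = 2 + (h₁ + f₁) * (radius a x - rPlus M a) := by
  rw [redShiftVec_apply, redShiftVector, hawkingVector_apply, nullVector_apply_zero,
    axialVector_apply_zero]
  simp [E4.basisVector]
  ring

/-! ## Part 3. Transversality to the admissible leaves on the horizon -/

/-- **The admissible conormals**: covectors `n = (1, −q)` with `|q| ≤ 1`, i.e. the conormals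
`dt* − dF` of the graphs `{t* = F(x⃗)}` with `‖∇F‖ ≤ 1` (a compact set of parameters).
[cite: DafermosRodnianskiShlapentokhrothman2014, §3.3] -/
def admissibleConormals : Set (Fin 4 → ℝ) := {n | n 0 = 1 ∧ ∑ i : Fin 3, n i.succ ^ 2 ≤ 1}

/-- The set of admissible conormals is compact. [folklore] -/
theorem isCompact_admissibleConormals : IsCompact admissibleConormals := by
  refine Metric.isCompact_of_isClosed_isBounded ?_ ?_
  · rw [admissibleConormals, Set.setOf_and]
    refine IsClosed.inter (isClosed_eq (continuous_apply 0) continuous_const) ?_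
    exact isClosed_le (continuous_finsetSum _ fun i _ ↦ (continuous_apply _).pow 2)
      continuous_const
  · rw [isBounded_iff_forall_norm_le]
    refine ⟨1, fun n hn ↦ ?_⟩
    refine (pi_norm_le_iff_of_nonneg zero_le_one).mpr fun μ ↦ ?_
    rw [Real.norm_eq_abs]
    obtain ⟨h0, hs⟩ := hn
    by_cases hμ : μ = 0
    · subst hμ; rw [h0, abs_one]
    · obtain ⟨i, rfl⟩ : ∃ i : Fin 3, i.succ = μ := Fin.exists_succ_eq.mpr hμ
      have hle : n i.succ ^ 2 ≤ 1 := le_trans (Finset.single_le_sum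
        (f := fun i : Fin 3 ↦ n i.succ ^ 2) (fun _ _ ↦ sq_nonneg _) (Finset.mem_univ i)) hs
      exact abs_le_one_iff_mul_self_le_one.mpr (by nlinarith [hle])

/-- **Cauchy–Schwarz for the admissible conormals**: `∑_μ n_μ N^μ ≥ N⁰ − ‖N⃗‖` for `n = (1, −q)`,
`|q| ≤ 1`. [folklore] -/
theorem apply_zero_sub_spatialNorm_le {n : Fin 4 → ℝ} (hn : n ∈ admissibleConormals) (v : E4) :
    v 0 - E4.spatialNorm v ≤ ∑ μ, n μ * v μ := by
  obtain ⟨h0, hs⟩ := hn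
  rw [Fin.sum_univ_succ, h0, one_mul]
  have hcs := Finset.sum_mul_sq_le_sq_mul_sq Finset.univ (fun i : Fin 3 ↦ n i.succ) (fun i ↦ v i.succ)
  have hv : ∑ i : Fin 3, v i.succ ^ 2 = E4.spatialNorm v ^ 2 := by
    rw [E4.spatialNorm_sq, Fin.sum_univ_three]
    rfl
  have hS0 : 0 ≤ E4.spatialNorm v := E4.spatialNorm_nonneg v
  have h2 : (∑ i : Fin 3, n i.succ * v i.succ) ^ 2 ≤ E4.spatialNorm v ^ 2 := by
    calc (∑ i : Fin 3, n i.succ * v i.succ) ^ 2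
        ≤ (∑ i : Fin 3, n i.succ ^ 2) * ∑ i : Fin 3, v i.succ ^ 2 := hcs
      _ ≤ 1 * ∑ i : Fin 3, v i.succ ^ 2 :=
          mul_le_mul_of_nonneg_right hs (Finset.sum_nonneg fun _ _ ↦ sq_nonneg _)
      _ = E4.spatialNorm v ^ 2 := by rw [one_mul, hv]
  have h3 : -E4.spatialNorm v ≤ ∑ i : Fin 3, n i.succ * v i.succ := by
    nlinarith [abs_le_of_sq_le_sq' h2 hS0]
  linarith

/-- `x₁² + x₂² ≤ r² + a²` wherever `r > 0` (the oblate-spheroidal relation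
`(x₁² + x₂²)/(r² + a²) + x₃²/r² = 1`). [cite: arXiv07060622, (35)] -/
theorem sq_add_sq_le_radius_sq_add (hx : 0 < radius a x) : x 1 ^ 2 + x 2 ^ 2 ≤ radius a x ^ 2 + a ^ 2 := by
  have h := spatialNorm_sq_le hx
  rw [E4.spatialNorm_sq] at h
  nlinarith [sq_nonneg (x 3)]

/-- `‖Φ⃗‖² = x₁² + x₂²` for the axial vector `Φ = x₁∂₂ − x₂∂₁`. [folklore] -/
theorem spatialNorm_axialVector_sq (x : E4) : E4.spatialNorm (axialVector x) ^ 2 = x 1 ^ 2 + x 2 ^ 2 := by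
  rw [E4.spatialNorm_sq, axialVector_apply_one, axialVector_apply_two, axialVector_apply_three]
  ring

/-- `‖ℓ⃗‖ = 1` wherever `r > 0`. [cite: arXiv07060622, (34)] -/
theorem spatialNorm_nullVector (hx : 0 < radius a x) : E4.spatialNorm (nullVector a x) = 1 := by
  have h : E4.spatialNorm (nullVector a x) ^ 2 = 1 := by
    rw [E4.spatialNorm_sq, nullVector_apply_one, nullVector_apply_two, nullVector_apply_three]
    exact sum_sq_nullCovectorFun hx
  have h0 := E4.spatialNorm_nonneg (nullVector a x)
  nlinarith [h, h0]

/-- **On the horizon `‖N⃗‖ ≤ 1 + |a|/√(r₊² + a²)`**: `N⃗ = ω₊Φ⃗ − ℓ⃗` with `|ℓ⃗| = 1`,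
`‖Φ⃗‖² = x₁² + x₂² ≤ r₊² + a²` and `ω₊ = a/(2Mr₊) = a/(r₊² + a²)`. [folklore] -/
theorem spatialNorm_redShiftVec_le_of_radius_eq_rPlus (h₁ f₁ : ℝ) (hMa : |a| ≤ M) (hM : 0 < M)
    (hr : radius a x = rPlus M a) :
    E4.spatialNorm (redShiftVec M a h₁ f₁ x) ≤ 1 + |a| / √(rPlus M a ^ 2 + a ^ 2) := by
  have hrp := rPlus_pos hM a
  have hx : 0 < radius a x := hr ▸ hrp
  have hQ : 0 < rPlus M a ^ 2 + a ^ 2 := by positivity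
  have hω : horizonAngularVelocity M a = a / (rPlus M a ^ 2 + a ^ 2) := by
    rw [horizonAngularVelocity, ← rPlus_sq_add_sq hMa]
  -- `N = K − ℓ♯` on the horizon
  have hN : redShiftVec M a h₁ f₁ x = hawkingVector M a x + (-1 : ℝ) • nullVector a x := by
    simp only [redShiftVec, hr, sub_self, mul_zero, add_zero, one_smul]
  have hK : hawkingVector M a x = E4.basisVector 0 + horizonAngularVelocity M a • axialVector x := rfl
  -- spatial parts
  have hsK : E4.spatialNorm (hawkingVector M a x) =
      |horizonAngularVelocity M a| * E4.spatialNorm (axialVector x) := by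
    have h0 : E4.spatial (E4.basisVector 0) = 0 := by
      ext i
      rw [E4.spatial_apply]
      fin_cases i <;> simp [E4.basisVector]
    rw [E4.spatialNorm, hK, map_add, map_smul, h0, zero_add, norm_smul, Real.norm_eq_abs,
      E4.spatialNorm]
  have hsum : E4.spatialNorm (redShiftVec M a h₁ f₁ x) ≤
      E4.spatialNorm (hawkingVector M a x) + E4.spatialNorm (nullVector a x) := by
    rw [E4.spatialNorm, hN, map_add, map_smul, E4.spatialNorm, E4.spatialNorm]
    calc ‖E4.spatial (hawkingVector M a x) + (-1 : ℝ) • E4.spatial (nullVector a x)‖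
        ≤ ‖E4.spatial (hawkingVector M a x)‖ + ‖(-1 : ℝ) • E4.spatial (nullVector a x)‖ :=
          norm_add_le _ _
      _ = ‖E4.spatial (hawkingVector M a x)‖ + ‖E4.spatial (nullVector a x)‖ := by
          rw [norm_smul]; simp
  rw [hsK, spatialNorm_nullVector hx] at hsum
  -- `|ω₊| ‖Φ⃗‖ ≤ |a| √(r₊² + a²)/(r₊² + a²) = |a|/√(r₊² + a²)`
  have hΦ : E4.spatialNorm (axialVector x) ≤ √(rPlus M a ^ 2 + a ^ 2) := by
    have h1 := spatialNorm_axialVector_sq x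
    have h2 := sq_add_sq_le_radius_sq_add (a := a) hx
    rw [hr] at h2
    have h3 : E4.spatialNorm (axialVector x) ^ 2 ≤ rPlus M a ^ 2 + a ^ 2 := by linarith
    calc E4.spatialNorm (axialVector x) = √(E4.spatialNorm (axialVector x) ^ 2) :=
          (Real.sqrt_sq (E4.spatialNorm_nonneg _)).symm
      _ ≤ √(rPlus M a ^ 2 + a ^ 2) := Real.sqrt_le_sqrt h3
  have hsq : √(rPlus M a ^ 2 + a ^ 2) ^ 2 = rPlus M a ^ 2 + a ^ 2 := Real.sq_sqrt hQ.le
  have hsqpos : 0 < √(rPlus M a ^ 2 + a ^ 2) := Real.sqrt_pos.mpr hQ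
  have hωΦ : |horizonAngularVelocity M a| * E4.spatialNorm (axialVector x) ≤
      |a| / √(rPlus M a ^ 2 + a ^ 2) := by
    rw [hω, abs_div, abs_of_pos hQ]
    calc |a| / (rPlus M a ^ 2 + a ^ 2) * E4.spatialNorm (axialVector x)
        ≤ |a| / (rPlus M a ^ 2 + a ^ 2) * √(rPlus M a ^ 2 + a ^ 2) :=
          mul_le_mul_of_nonneg_left hΦ (by positivity)
      _ = |a| / √(rPlus M a ^ 2 + a ^ 2) := by
          rw [div_mul_eq_mul_div, div_eq_div_iff hQ.ne' hsqpos.ne']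
          nlinarith [hsq]
  linarith

/-- `|a| < √(r₊² + a²)` (`r₊ > 0`), so `1 − |a|/√(r₊² + a²) > 0`. [folklore] -/
theorem abs_div_sqrt_rPlus_sq_add_sq_lt_one (hM : 0 < M) (a : ℝ) :
    |a| / √(rPlus M a ^ 2 + a ^ 2) < 1 := by
  have hrp := rPlus_pos hM a
  have hQ : 0 < rPlus M a ^ 2 + a ^ 2 := by positivity
  have hsqpos : 0 < √(rPlus M a ^ 2 + a ^ 2) := Real.sqrt_pos.mpr hQ
  rw [div_lt_one hsqpos]
  have h1 : |a| = √(a ^ 2) := (Real.sqrt_sq_eq_abs a).symm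
  rw [h1]
  exact Real.sqrt_lt_sqrt (sq_nonneg a) (by nlinarith)

/-- **`N` is uniformly transversal to the admissible leaves on the horizon**: for every
admissible conormal `n = (1, −q)`, `|q| ≤ 1`, at every point of `{r = r₊}`:
`∑_μ n_μ N^μ ≥ 1 − |a|/√(r₊² + a²) > 0` (`N⁰ = 2`, `‖N⃗‖ ≤ 1 + |a|/√(r₊² + a²)`). In particular
`n(N) > 0` for the conormal `n = dt* − dF` of every graph with `‖∇F‖ ≤ 1`: with `N` timelike this is
the co-orientation hypothesis of the dominant energy condition for the flux `−∑_μ (J^N)^μ n_μ`.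
[cite: DafermosRodnianskiShlapentokhrothman2014, Prop. 4.5.1] -/
theorem one_sub_le_sum_mul_redShiftVec_of_radius_eq_rPlus (h₁ f₁ : ℝ) (hMa : |a| ≤ M) (hM : 0 < M)
    (hr : radius a x = rPlus M a) {n : Fin 4 → ℝ} (hn : n ∈ admissibleConormals) :
    1 - |a| / √(rPlus M a ^ 2 + a ^ 2) ≤ ∑ μ, n μ * redShiftVec M a h₁ f₁ x μ := by
  have h1 := apply_zero_sub_spatialNorm_le hn (redShiftVec M a h₁ f₁ x)
  have h2 := spatialNorm_redShiftVec_le_of_radius_eq_rPlus h₁ f₁ hMa hM hr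
  have h0 : redShiftVec M a h₁ f₁ x 0 = 2 := by
    rw [redShiftVec_apply_zero, hr, sub_self, mul_zero, add_zero]
  linarith

/-! ## Part 4. Regularity and stationarity; the timelike collar -/

/-- `x ↦ N(x)` is `C^n` (as an `E4`-valued map) wherever `r > 0`. [folklore] -/
theorem contDiffAt_redShiftVec (M a h₁ f₁ : ℝ) (hx : 0 < radius a x) {n : WithTop ℕ∞} :
    ContDiffAt ℝ n (redShiftVec M a h₁ f₁) x := by
  unfold redShiftVec
  have hr : ContDiffAt ℝ n (fun y ↦ radius a y - rPlus M a) x :=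
    (contDiffAt_radius hx).sub contDiffAt_const
  have hK : ContDiff ℝ n (hawkingVector M a) :=
    contDiff_euclidean.mpr fun μ ↦ contDiff_hawkingVector_apply M a μ
  exact ((contDiffAt_const.add (contDiffAt_const.mul hr)).smul hK.contDiffAt).add
    ((contDiffAt_const.add (contDiffAt_const.mul hr)).neg.smul (contDiffAt_nullVector a hx))

/-- `N` (as a vector) is invariant under `t*`-translations. [cite: DafermosRodnianskiShlapentokhrothman2014, Prop. 4.5.1] -/
theorem redShiftVec_add_smul_basisVector_zero (M a h₁ f₁ : ℝ) (x : E4) (t : ℝ) :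
    redShiftVec M a h₁ f₁ (x + t • E4.basisVector 0) = redShiftVec M a h₁ f₁ x := by
  simp only [redShiftVec, radius_add_time_smul_basisVector, hawkingVector_add_smul_basisVector_zero,
    nullVector_add_smul_basisVector_zero]

/-- `x ↦ g_x(N(x), N(x))` is continuous on `{r > 0}`. [folklore] -/
theorem continuousOn_bilin_redShiftVec (M a h₁ f₁ : ℝ) :
    ContinuousOn (fun x ↦ bilin M a x (redShiftVec M a h₁ f₁ x) (redShiftVec M a h₁ f₁ x))
      {x | 0 < radius a x} := by
  intro x hx
  have hb := (contDiffAt_bilin M a hx (n := 1)).continuousAt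
  have hN := (contDiffAt_redShiftVec M a h₁ f₁ hx (n := 1)).continuousAt
  exact ((hb.clm_apply hN).clm_apply hN).continuousWithinAt

/-- `(x, n) ↦ ∑_μ n_μ N^μ(x)` is continuous on `{r > 0} × (Fin 4 → ℝ)`. [folklore] -/
theorem continuousOn_sum_mul_redShiftVec (M a h₁ f₁ : ℝ) (T : Set (Fin 4 → ℝ)) :
    ContinuousOn (fun q : E4 × (Fin 4 → ℝ) ↦ ∑ μ, q.2 μ * redShiftVec M a h₁ f₁ q.1 μ)
      ({x | 0 < radius a x} ×ˢ T) := by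
  refine continuousOn_finsetSum _ fun μ _ ↦ ?_
  have hp : ContinuousOn (fun q : E4 × (Fin 4 → ℝ) ↦ q.2 μ) ({x | 0 < radius a x} ×ˢ T) :=
    ((continuous_apply μ).comp continuous_snd).continuousOn
  refine hp.mul fun q hq ↦ ?_
  have hN := (contDiffAt_redShiftVec M a h₁ f₁ hq.1 (n := 1)).continuousAt
  have hμ : Continuous fun v : E4 ↦ v μ := (E4.dx μ).continuous
  exact ((hμ.continuousAt.comp hN).comp continuousAt_fst).continuousWithinAt

/-- **The red-shift multiplier is future timelike and uniformly transversal to the admissible leaves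
on a collar of the horizon** (Dafermos–Rodnianski–Shlapentokh-Rothman Prop. 4.5.1: "a
`φ_τ`-invariant timelike vector field `N`", near `𝓗⁺`, with uniform constants). For `|a| < M` and
any parameters `h₁, f₁` there are `η > 0` and `b > 0` such that at every point `x` with
`|r(x) − r₊| ≤ η`: `g(N, N) ≤ −b` (timelike, uniformly), `1 ≤ N⁰` (future directed: `dt*(N) > 0`),
and `b ≤ ∑_μ n_μ N^μ` for every admissible conormal `n = (1, −q)`, `|q| ≤ 1` (the co-orientation
`n(N) > 0` with every graph `{t* = F(x⃗)}`, `‖∇F‖ ≤ 1`). Proof: the collar principle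
(`exists_collar_of_pos_on_horizon`) applied to `−g(N, N)` and to `(x, n) ↦ ∑ n_μ N^μ`, which are
continuous on `{r > 0}`, `t*`-invariant, and positive on `{r = r₊}` by
`bilin_redShiftVec_neg_of_radius_eq_rPlus` and `one_sub_le_sum_mul_redShiftVec_of_radius_eq_rPlus`;
`N⁰ = 2 + (h₁ + f₁)(r − r₊) ≥ 1` for `|r − r₊| ≤ 1/(|h₁| + |f₁| + 1)`.
[cite: DafermosRodnianskiShlapentokhrothman2014, Prop. 4.5.1] -/
theorem exists_redShift_timelike_collar (hMa : IsSubextremal M a) (h₁ f₁ : ℝ) :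
    ∃ η : ℝ, 0 < η ∧ ∃ b : ℝ, 0 < b ∧ ∀ x : E4, |radius a x - rPlus M a| ≤ η →
      bilin M a x (redShiftVec M a h₁ f₁ x) (redShiftVec M a h₁ f₁ x) ≤ -b ∧
        1 ≤ redShiftVec M a h₁ f₁ x 0 ∧
        ∀ n ∈ admissibleConormals, b ≤ ∑ μ, n μ * redShiftVec M a h₁ f₁ x μ := by
  have hM : 0 < M := hMa.pos
  have hMa' : |a| ≤ M := le_of_lt hMa
  have hrp : 0 < rPlus M a := rPlus_pos hM a
  -- (1) timelike: the collar principle for `−g(N, N)`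
  obtain ⟨η₁, hη₁, b₁, hb₁, h1⟩ := exists_collar_of_pos_on_horizon' a hrp
    (fun x ↦ -bilin M a x (redShiftVec M a h₁ f₁ x) (redShiftVec M a h₁ f₁ x))
    (continuousOn_bilin_redShiftVec M a h₁ f₁).neg
    (fun x t ↦ by rw [bilin_add_smul_basisVector_zero, redShiftVec_add_smul_basisVector_zero])
    (fun x hx ↦ neg_pos.mpr (bilin_redShiftVec_neg_of_radius_eq_rPlus h₁ f₁ hMa' hM hx))
  -- (2) transversality: the collar principle with the compact parameter set of admissible conormals
  obtain ⟨η₂, hη₂, b₂, hb₂, h2⟩ := exists_collar_of_pos_on_horizon a hrp isCompact_admissibleConormals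
    (fun x n ↦ ∑ μ, n μ * redShiftVec M a h₁ f₁ x μ)
    (continuousOn_sum_mul_redShiftVec M a h₁ f₁ admissibleConormals)
    (fun x t n ↦ by rw [redShiftVec_add_smul_basisVector_zero])
    (fun x hx n hn ↦ lt_of_lt_of_le (sub_pos.mpr (abs_div_sqrt_rPlus_sq_add_sq_lt_one hM a))
      (one_sub_le_sum_mul_redShiftVec_of_radius_eq_rPlus h₁ f₁ hMa' hM hx hn))
  -- (3) `N⁰ ≥ 1` on `|r − r₊| ≤ 1/(|h₁| + |f₁| + 1)`
  set η₃ : ℝ := 1 / (|h₁| + |f₁| + 1) with hη₃_def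
  have hη₃ : 0 < η₃ := by positivity
  have h3 : ∀ x : E4, |radius a x - rPlus M a| ≤ η₃ → 1 ≤ redShiftVec M a h₁ f₁ x 0 := by
    intro x hx
    rw [redShiftVec_apply_zero]
    set s := radius a x - rPlus M a
    have hs : |s| ≤ η₃ := hx
    have hprod : |(h₁ + f₁) * s| ≤ 1 := by
      rw [abs_mul]
      have hhf : |h₁ + f₁| ≤ |h₁| + |f₁| := abs_add_le _ _
      have hpos : 0 < |h₁| + |f₁| + 1 := by positivity
      have e1 : (|h₁| + |f₁| + 1) * η₃ = 1 := by rw [hη₃_def]; field_simp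
      calc |h₁ + f₁| * |s| ≤ (|h₁| + |f₁|) * η₃ :=
            mul_le_mul hhf hs (abs_nonneg _) (by positivity)
        _ ≤ (|h₁| + |f₁| + 1) * η₃ := mul_le_mul_of_nonneg_right (by linarith) hη₃.le
        _ = 1 := e1
    have := (abs_le.mp hprod).1
    linarith
  refine ⟨min η₁ (min η₂ η₃), lt_min hη₁ (lt_min hη₂ hη₃), min b₁ b₂, lt_min hb₁ hb₂,
    fun x hx ↦ ⟨?_, ?_, ?_⟩⟩
  · have := h1 x (hx.trans (min_le_left _ _))
    have hb := min_le_left b₁ b₂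
    linarith
  · exact h3 x (hx.trans ((min_le_right _ _).trans (min_le_right _ _)))
  · intro n hn
    have := h2 x (hx.trans ((min_le_right _ _).trans (min_le_left _ _))) n hn
    exact (min_le_right b₁ b₂).trans this


end Kerr

end Literature.Geometry.Lorentzian
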